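/-
Copyright (c) 2026 the pub-hodgecm-mathlib formalisation cell (harness21).  Prover seat hodgecm-mathlib-LH1-p01 (g12) on the N8-INNER road (ROAD B «EP road», road owner
LH2-plan (g1)), brick (8) «WALL EP GENERATOR», part (8d): the BLOCK generator at a semiregular wall point — ★ (W3-G)'s compact-type rank-one generator read on the `W`-block; 2026-09-02.
-/
import Literature.NumberTheory.Rogawski1990.ArchRankOneWallGenerators          -- ★ p851615 (LH3-p02 (g5)) (W3-G): `exists_compactType_wallGenerator` (the rank-one compact-type wall generator on `U(Φ₂)_w`)
import Literature.NumberTheory.Automorphic.UnitarySliceGeneratorTwoBlock       -- ★ p852153 (this seat) (8b′): `coe_coe_gprimeBlockAt_of_not_mem` (the wall point's matrix); brings `gprimeBlockAt`, `archLocal`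
import Mathlib.Analysis.Calculus.BumpFunction.FiniteDimension                  -- Mathlib: `exists_contDiff_tsupport_subset`
import HarnessLib

/-!
# (8d) The BLOCK WALL GENERATOR: an ambient `C^∞` function `Φ(X) = f₀(P·X_W·P⁻¹) · b(X₁)` whose restriction to the centraliser `Z(s)` of a wall point of `U(α)_w` is
# ★ (W3-G)'s compact-type rank-one generator on the `W`-block times a bump on the line (Rogawski 1990 §8.2; Varadarajan 1989 §6.4; Shelstad 1979 Lemma 4.3)

Topic `NumberTheory/Rogawski1990`; namespace `Literature.NumberTheory.Rogawski1990`.  THEOREMS ONLY (no definition, no instance, no notation, no axiom, no named fact, no `sorry`);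
kernel lane `--kind proof --supports stmt-HodgeConjecture-24833`.  Cell `pub/hodgecm-mathlib`, crux H413 = `stmt-HodgeConjecture-24833`; N8-INNER ROAD B, brick **(8) «WALL EP
GENERATOR (one place)»**, binder LH1-p01 (g12), part **(8d)** (SEAM MEMO `F0/P3c/LH1/LH1-p01/g12/brick8/SEAMS-8cde.v1.LH1p01g12.md`).  Author LH1-p01 (g12).

THE MATHEMATICS.  At the wall point `s = gprimeBlockAt L α w S′ cw₀` (`w ∉ S′`, `cw₀ 0 = cw₀ 2 =: θ`, `e^{i cw₀ 1} ≠ e^{iθ}`) the matrix `↑s = diag d` has `d(τ0) = d(τ2) = e^{iθ}`,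
`d(τ1) = e^{i cw₀ 1}` (`τ = lineOf (formSign L α w)`, ★ (8b′)).  A matrix commuting with `diag d` has VANISHING entries across the two values (§1), so every `z ∈ Z(s)` is
determined by its `W`-block `z_W = z.submatrix ι ι` (`ι = τ ∘ ![0,2]`) and its line entry `z₁ = z (τ1) (τ1)`: `↑z = A(z_W, z₁)` for the continuous linear block assembly `A` (§1).
★ (8b′) `exists_sliceGenerator_gprimeBlockAt_wall` asks for an ambient `C^∞` block function `Φ` supported, ON `Z(s)`, in a prescribed slice neighbourhood `V₀` of `↑s`.  §2 builds it:
**`Φ(X) := f₀(P · X_W · P⁻¹) · b(X₁)`** with `f₀ ∈ C_c^∞(M₂(ℂ))` the ★ (W3-G) COMPACT-TYPE WALL GENERATOR `exists_compactType_wallGenerator` at the centre `e^{iθ}·1` (split readings `0`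
near the wall (G1-w); Harish-Chandra's non-zero `∂_ψ`-limit (G3-w)) placed in the `P`-conjugate of a small neighbourhood, `P ∈ GL₂(ℂ)` ANY fixed frame change (the consumer passes ★
(B-STD)'s standardising matrix, so that `Φ ↑z = f₀ ↑(φ z_W) · b(z₁)` with `φ : B_w ≃ₜ* U(J)` of ★ `exists_std_package`), and `b ∈ C_c^∞(ℂ)` a bump `= 1` at `e^{i cw₀ 1}`; the
neighbourhoods are chosen by continuity of `A` at `(e^{iθ}·1, e^{i cw₀ 1})` so that `z ∈ Z(s)`, `Φ ↑z ≠ 0` forces `↑z ∈ V₀`.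
* §1 `apply_eq_zero_of_commute_diagonal` (entries across distinct diagonal values vanish), `coe_eq_blockAssembly_of_mem_centralizer` (the block assembly identity on `Z(s)`).
* §2 HEAD **`exists_blockWallGenerator`**.
HONEST LABEL: HC_CM is proved only modulo the 7 printed citations (2 remaining: hLiu418 = `stmt-HodgeConjecture-24832`, h413 = `stmt-HodgeConjecture-24833`) until rung 0 closes;
count-neutral (pays nothing by itself).

## References
* [Rogawski1990] J. D. Rogawski, *Automorphic Representations of Unitary Groups in Three Variables*, Ann. of Math. Stud. 123 (1990), §8.2 Prop. 8.2.1 pp. 119, 122–123.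
* [Varadarajan1989] V. S. Varadarajan, *An Introduction to Harmonic Analysis on Semisimple Lie Groups*, Cambridge Stud. Adv. Math. 16 (1989), §6.4 Thm 22, Thm 23.
* [Shelstad1979] D. Shelstad, *Characters and inner forms of a quasi-split group over ℝ*, Compositio Math. 39 (1979), Lemma 4.3 p. 25.
-/

set_option autoImplicit false

noncomputable section

open MeasureTheory MeasureTheory.Measure Set Filter Topology NumberField NumberField.InfinitePlace Complex Function Metric
open scoped ENNReal NNReal Real MatrixGroups Matrix ContDiff Matrix.Norms.Operator

namespace Literature.NumberTheory.Rogawski1990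

open Literature.NumberTheory.Automorphic Literature.NumberTheory.Automorphic.UnitaryGroup Literature.MeasureTheory.Group

/-! ## §1 Matrices commuting with a two-valued diagonal are block diagonal -/

section Block

/-- **A matrix commuting with `diag d` has zero entries across distinct diagonal values.** [cite: Rogawski1990, §8.2 p. 122] -/
theorem apply_eq_zero_of_commute_diagonal {n : Type*} [Fintype n] [DecidableEq n] {K : Type*} [Field K] {d : n → K} {z : Matrix n n K}
    (h : Commute z (Matrix.diagonal d)) {i j : n} (hij : d i ≠ d j) : z i j = 0 := by
  have h1 := congrFun (congrFun h.eq i) j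
  rw [Matrix.mul_diagonal, Matrix.diagonal_mul] at h1
  -- `z i j * d j = d i * z i j`
  have h2 : z i j * (d j - d i) = 0 := by rw [mul_sub, h1]; ring
  rcases mul_eq_zero.1 h2 with h3 | h3
  · exact h3
  · exact absurd (sub_eq_zero.1 h3).symm hij

/-- **THE BLOCK ASSEMBLY IDENTITY on the centraliser of a `{τ0,τ2}∣{τ1}` two-valued diagonal**: if `z` commutes with `diag d`, `d (τ 0) = d (τ 2) ≠ d (τ 1)`, then
`z = A(z_W, z₁)` where `A(Y, ζ) i j = ζ` at `(τ1, τ1)`, `0` on the other entries of row∕column `τ1`, and `Y (κ i) (κ j)` elsewhere (`κ (τ2) = 1`, `κ = 0` otherwise),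
`z_W = z.submatrix (τ ∘ ![0,2]) (τ ∘ ![0,2])`, `z₁ = z (τ1) (τ1)`. [cite: Rogawski1990, §8.2 p. 122] -/
theorem apply_eq_blockAssembly_of_commute_diagonal {K : Type*} [Field K] (τ : Fin 3 ≃ Fin 3) {d : Fin 3 → K} (h02 : d (τ 0) = d (τ 2)) (h1 : d (τ 1) ≠ d (τ 0))
    {z : Matrix (Fin 3) (Fin 3) K} (hz : Commute z (Matrix.diagonal d)) (i j : Fin 3) :
    z i j = if i = τ 1 then (if j = τ 1 then z (τ 1) (τ 1) else 0)
      else if j = τ 1 then 0 else (z.submatrix (fun k : Fin 2 => τ (![0, 2] k)) (fun k : Fin 2 => τ (![0, 2] k))) (if i = τ 2 then 1 else 0) (if j = τ 2 then 1 else 0) := by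
  have h12 : d (τ 1) ≠ d (τ 2) := by rw [← h02]; exact h1
  -- which line is `i`?
  have hcases : ∀ k : Fin 3, k = τ 0 ∨ k = τ 1 ∨ k = τ 2 := by
    intro k
    obtain ⟨m, rfl⟩ := τ.surjective k
    fin_cases m
    · exact Or.inl rfl
    · exact Or.inr (Or.inl rfl)
    · exact Or.inr (Or.inr rfl)
  have hτ01 : τ 0 ≠ τ 1 := fun h => by have := τ.injective h; exact absurd this (by decide)
  have hτ21 : τ 2 ≠ τ 1 := fun h => by have := τ.injective h; exact absurd this (by decide)
  have hτ02 : τ 0 ≠ τ 2 := fun h => by have := τ.injective h; exact absurd this (by decide)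
  by_cases hi : i = τ 1
  · subst hi
    rw [if_pos rfl]
    by_cases hj : j = τ 1
    · subst hj; rw [if_pos rfl]
    · rw [if_neg hj]
      rcases hcases j with hj0 | hj1 | hj2
      · subst hj0; exact apply_eq_zero_of_commute_diagonal hz h1
      · exact absurd hj1 hj
      · subst hj2; exact apply_eq_zero_of_commute_diagonal hz h12
  · rw [if_neg hi]
    by_cases hj : j = τ 1
    · subst hj
      rw [if_pos rfl]
      rcases hcases i with hi0 | hi1 | hi2
      · subst hi0; exact apply_eq_zero_of_commute_diagonal hz (Ne.symm h1)
      · exact absurd hi1 hi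
      · subst hi2; exact apply_eq_zero_of_commute_diagonal hz (Ne.symm h12)
    · rw [if_neg hj, Matrix.submatrix_apply]
      rcases hcases i with hi0 | hi1 | hi2
      · rcases hcases j with hj0 | hj1 | hj2
        · subst hi0; subst hj0; simp [hτ02]
        · exact absurd hj1 hj
        · subst hi0; subst hj2; simp [hτ02]
      · exact absurd hi1 hi
      · rcases hcases j with hj0 | hj1 | hj2
        · subst hi2; subst hj0; simp [hτ02]
        · exact absurd hj1 hj
        · subst hi2; subst hj2; simp

end Block

/-! ## §2 The block wall generator -/

section Generator

variable (L : Type) [Field L] [NumberField L] [IsCMField L] (α : Fin 3 → L) (w : {w : InfinitePlace L // IsComplex w})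
  (S' : Finset {w : InfinitePlace L // IsComplex w})
  [MeasurableSpace ↥(archLocal L 2 (Matrix.of fun i j : Fin 2 => if i.val + j.val + 1 = 2 then (1 : L) else 0) w)]
  [BorelSpace ↥(archLocal L 2 (Matrix.of fun i j : Fin 2 => if i.val + j.val + 1 = 2 then (1 : L) else 0) w)]
  (νw : Measure ↥(archLocal L 2 (Matrix.of fun i j : Fin 2 => if i.val + j.val + 1 = 2 then (1 : L) else 0) w)) [νw.IsHaarMeasure] [νw.IsMulRightInvariant]

set_option maxHeartbeats 400000 in
/-- **(8d) THE BLOCK WALL GENERATOR.**  `s := gprimeBlockAt L α w S′ cw₀` a wall point (`w ∉ S′`, `cw₀ 0 = cw₀ 2`, `e^{i cw₀ 1} ≠ e^{i cw₀ 0}`), `Z := Z(s)`, `τ := lineOf (formSign L α w)`,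
`P ∈ GL₂(ℂ)` any frame change, `V₀` any neighbourhood of `↑s`.  There are `Φ : M₃(ℂ) → ℂ` (`C^∞`), the ★ (W3-G) compact-type generator `f₀ ∈ C_c^∞(M₂(ℂ))` at the centre
`e^{i cw₀ 0}·1` with its constants `C < 0`, `δ > 0`, and a bump `b ∈ C^∞(ℂ, [0,1])` with `b(e^{i cw₀ 1}) = 1`, such that: `Φ X = f₀ (P · X_W · P⁻¹) · b (X (τ1) (τ1))` for EVERY
matrix `X` (`X_W = X.submatrix (τ ∘ ![0,2]) (τ ∘ ![0,2])`); `z ∈ Z`, `Φ ↑z ≠ 0 ⇒ ↑z ∈ V₀` (the support clause of ★ (8b′)); `f₀ (e^{i cw₀ 0}·1) = 1`; (G1-w) the SPLIT readings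
of `f₀` on `U(Φ₂)_w` vanish near the wall; (G3-w) the `∂_ψ`-derivative of the twisted COMPACT reading of `f₀` tends to `C` (both clauses of ★ `exists_compactType_wallGenerator` VERBATIM).
[cite: Rogawski1990, §8.2 Prop. 8.2.1 p. 119, pp. 122–123] [cite: Varadarajan1989, §6.4 Thm 23] [cite: Shelstad1979, Lemma 4.3 p. 25] -/
theorem exists_blockWallGenerator {w : {w : InfinitePlace L // IsComplex w}} {S' : Finset {w : InfinitePlace L // IsComplex w}} (hw : w ∉ S')
    [MeasurableSpace ↥(archLocal L 2 (Matrix.of fun i j : Fin 2 => if i.val + j.val + 1 = 2 then (1 : L) else 0) w)]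
    [BorelSpace ↥(archLocal L 2 (Matrix.of fun i j : Fin 2 => if i.val + j.val + 1 = 2 then (1 : L) else 0) w)]
    (νw : Measure ↥(archLocal L 2 (Matrix.of fun i j : Fin 2 => if i.val + j.val + 1 = 2 then (1 : L) else 0) w)) [νw.IsHaarMeasure] [νw.IsMulRightInvariant]
    (cw₀ : Fin 3 → ℝ) (h02 : cw₀ 0 = cw₀ 2) (h1 : Circle.exp (cw₀ 1) ≠ Circle.exp (cw₀ 0)) (P : GL (Fin 2) ℂ)
    (V₀ : Set (Matrix (Fin 3) (Fin 3) ℂ)) (hV₀ : V₀ ∈ 𝓝 (((gprimeBlockAt L α w S' cw₀ : ↥(archLocal L 3 (Matrix.diagonal α) w)) : GL (Fin 3) ℂ) : Matrix (Fin 3) (Fin 3) ℂ)) :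
    ∃ (Φ : Matrix (Fin 3) (Fin 3) ℂ → ℂ) (f₀ : Matrix (Fin 2) (Fin 2) ℂ → ℂ) (b : ℂ → ℝ) (C δ : ℝ),
      ContDiff ℝ ∞ Φ ∧ ContDiff ℝ ∞ f₀ ∧ HasCompactSupport f₀ ∧ ContDiff ℝ ∞ b ∧ (∀ ζ, 0 ≤ b ζ ∧ b ζ ≤ 1) ∧ b ((Circle.exp (cw₀ 1) : Circle) : ℂ) = 1 ∧
      (∀ X : Matrix (Fin 3) (Fin 3) ℂ, Φ X =
        f₀ ((P : Matrix (Fin 2) (Fin 2) ℂ) * X.submatrix (fun k : Fin 2 => lineOf (formSign L α w) (![0, 2] k)) (fun k : Fin 2 => lineOf (formSign L α w) (![0, 2] k)) *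
              ((P⁻¹ : GL (Fin 2) ℂ) : Matrix (Fin 2) (Fin 2) ℂ)) *
          (b (X (lineOf (formSign L α w) 1) (lineOf (formSign L α w) 1)) : ℂ)) ∧
      (∀ z : ↥(archLocal L 3 (Matrix.diagonal α) w), z ∈ Subgroup.centralizer ({gprimeBlockAt L α w S' cw₀} : Set ↥(archLocal L 3 (Matrix.diagonal α) w)) →
        Φ ((z : GL (Fin 3) ℂ) : Matrix (Fin 3) (Fin 3) ℂ) ≠ 0 → ((z : GL (Fin 3) ℂ) : Matrix (Fin 3) (Fin 3) ℂ) ∈ V₀) ∧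
      f₀ ((((Circle.exp (cw₀ 0) : Circle) : ℂ)) • 1) = 1 ∧ C < 0 ∧ 0 < δ ∧
      (∀ S : Finset {w : InfinitePlace L // IsComplex w}, w ∈ S → ∀ cw : Fin 3 → ℝ, cw 0 ≠ 0 → |cw 0| < δ → dist (Circle.exp (cw 2)) (Circle.exp (cw₀ 0)) < δ →
        chartOrbHLoc L S w νw (fun g => f₀ ((g : GL (Fin 2) ℂ) : Matrix (Fin 2) (Fin 2) ℂ)) cw = 0) ∧
      Tendsto (fun ψ : ℝ => deriv (fun ψ : ℝ => (2 * Real.sin ψ) •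
          ∫ h : ↥(archLocal L 2 (Matrix.of fun i j : Fin 2 => if i.val + j.val + 1 = 2 then (1 : L) else 0) w),
            f₀ (((h * ⟨Matrix.GeneralLinearGroup.mkOfDetNeZero !![(1 : ℂ), 1; 1, -1] det_cayleyTwo_ne_zero *
                  circleDiagonal 2 ![Circle.exp (cw₀ 0) * Circle.exp ψ, Circle.exp (cw₀ 0) * Circle.exp (-ψ)] *
                  (Matrix.GeneralLinearGroup.mkOfDetNeZero !![(1 : ℂ), 1; 1, -1] det_cayleyTwo_ne_zero)⁻¹,
                cayley_conj_circleDiagonal_mem_archLocal L w _⟩ * h⁻¹ :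
              ↥(archLocal L 2 (Matrix.of fun i j : Fin 2 => if i.val + j.val + 1 = 2 then (1 : L) else 0) w)) : GL (Fin 2) ℂ) : Matrix (Fin 2) (Fin 2) ℂ) ∂νw) ψ)
        (𝓝[≠] 0) (𝓝 ((C : ℝ) : ℂ)) := by
  classical
  -- ### notation
  set τ : Fin 3 ≃ Fin 3 := lineOf (formSign L α w) with hτ
  set ι : Fin 2 → Fin 3 := fun k => τ (![0, 2] k) with hι
  set s : ↥(archLocal L 3 (Matrix.diagonal α) w) := gprimeBlockAt L α w S' cw₀ with hsdef
  set d : Fin 3 → ℂ := fun ℓ => Complex.exp ((cw₀ (τ.symm ℓ) : ℂ) * Complex.I) with hd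
  have hsd : ((s : GL (Fin 3) ℂ) : Matrix (Fin 3) (Fin 3) ℂ) = Matrix.diagonal d := coe_coe_gprimeBlockAt_of_not_mem L α hw cw₀
  have hd0 : d (τ 0) = Complex.exp ((cw₀ 0 : ℂ) * Complex.I) := by simp only [hd, Equiv.symm_apply_apply]
  have hd1 : d (τ 1) = Complex.exp ((cw₀ 1 : ℂ) * Complex.I) := by simp only [hd, Equiv.symm_apply_apply]
  have hd2 : d (τ 2) = Complex.exp ((cw₀ 0 : ℂ) * Complex.I) := by simp only [hd, Equiv.symm_apply_apply, ← h02]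
  have hd02 : d (τ 0) = d (τ 2) := by rw [hd0, hd2]
  have hd10 : d (τ 1) ≠ d (τ 0) := by
    rw [hd1, hd0]
    intro h
    exact h1 (Subtype.ext (by rw [Circle.coe_exp, Circle.coe_exp]; exact h))
  set zc : ℂ := ((Circle.exp (cw₀ 0) : Circle) : ℂ) with hzc
  set z1 : ℂ := ((Circle.exp (cw₀ 1) : Circle) : ℂ) with hz1
  -- ### the block assembly map and its continuity
  set A : Matrix (Fin 2) (Fin 2) ℂ × ℂ → Matrix (Fin 3) (Fin 3) ℂ := fun q => Matrix.of fun i j =>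
      if i = τ 1 then (if j = τ 1 then q.2 else 0) else if j = τ 1 then 0 else q.1 (if i = τ 2 then 1 else 0) (if j = τ 2 then 1 else 0) with hA
  have hAc : Continuous A := by
    refine continuous_pi fun i => continuous_pi fun j => ?_
    simp only [hA, Matrix.of_apply]
    split_ifs <;> first
      | exact continuous_snd
      | exact continuous_const
      | exact (continuous_apply_apply _ _).comp continuous_fst
  -- `A (zc • 1, z1) = ↑s`
  have hAs : A (zc • (1 : Matrix (Fin 2) (Fin 2) ℂ), z1) = Matrix.diagonal d := by
    ext i j
    simp only [hA, Matrix.of_apply]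
    have hcases : ∀ k : Fin 3, k = τ 0 ∨ k = τ 1 ∨ k = τ 2 := by
      intro k
      obtain ⟨m, rfl⟩ := τ.surjective k
      fin_cases m
      · exact Or.inl rfl
      · exact Or.inr (Or.inl rfl)
      · exact Or.inr (Or.inr rfl)
    have hτ01 : τ 0 ≠ τ 1 := fun h => by have := τ.injective h; exact absurd this (by decide)
    have hτ21 : τ 2 ≠ τ 1 := fun h => by have := τ.injective h; exact absurd this (by decide)
    have hτ02 : τ 0 ≠ τ 2 := fun h => by have := τ.injective h; exact absurd this (by decide)
    have hzc' : zc = d (τ 0) := by rw [hd0, hzc, Circle.coe_exp]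
    have hz1' : z1 = d (τ 1) := by rw [hd1, hz1, Circle.coe_exp]
    rcases hcases i with hi | hi | hi <;> rcases hcases j with hj | hj | hj <;> subst hi <;> subst hj <;>
      simp [hτ01, hτ21, hτ02, hτ01.symm, hτ21.symm, hτ02.symm, hzc', hz1', hd02]
  -- ### the two small neighbourhoods from continuity of `A` at `(zc•1, z1)`
  have hV₀' : V₀ ∈ 𝓝 (A (zc • (1 : Matrix (Fin 2) (Fin 2) ℂ), z1)) := by rw [hAs, ← hsd]; exact hV₀
  obtain ⟨UW, hUW, U1, hU1, hWU⟩ := mem_nhds_prod_iff.1 (hAc.continuousAt.preimage_mem_nhds hV₀')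
  -- the `P`-conjugate neighbourhood for `f₀`
  set conjP : Matrix (Fin 2) (Fin 2) ℂ → Matrix (Fin 2) (Fin 2) ℂ := fun Y => (P : Matrix (Fin 2) (Fin 2) ℂ) * Y * ((P⁻¹ : GL (Fin 2) ℂ) : Matrix (Fin 2) (Fin 2) ℂ) with hconjP
  set conjP' : Matrix (Fin 2) (Fin 2) ℂ → Matrix (Fin 2) (Fin 2) ℂ := fun Y => ((P⁻¹ : GL (Fin 2) ℂ) : Matrix (Fin 2) (Fin 2) ℂ) * Y * (P : Matrix (Fin 2) (Fin 2) ℂ) with hconjP'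
  have hPP : (P : Matrix (Fin 2) (Fin 2) ℂ) * ((P⁻¹ : GL (Fin 2) ℂ) : Matrix (Fin 2) (Fin 2) ℂ) = 1 := by
    rw [← Units.val_mul, mul_inv_cancel, Units.val_one]
  have hPP' : ((P⁻¹ : GL (Fin 2) ℂ) : Matrix (Fin 2) (Fin 2) ℂ) * (P : Matrix (Fin 2) (Fin 2) ℂ) = 1 := by
    rw [← Units.val_mul, inv_mul_cancel, Units.val_one]
  have hconj_inv : ∀ Y, conjP' (conjP Y) = Y := fun Y => by
    simp only [hconjP, hconjP']
    rw [← mul_assoc, ← mul_assoc, hPP', one_mul, mul_assoc, hPP', mul_one]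
  have hconjP'c : Continuous conjP' := (continuous_const.mul continuous_id).mul continuous_const
  have hconjPsmooth : ContDiff ℝ ∞ conjP := (contDiff_const.mul contDiff_id).mul contDiff_const
  have hconj_zc : conjP (zc • (1 : Matrix (Fin 2) (Fin 2) ℂ)) = zc • (1 : Matrix (Fin 2) (Fin 2) ℂ) := by
    simp only [hconjP]; rw [Matrix.mul_smul, Matrix.mul_one, Matrix.smul_mul, hPP]
  have hUf : conjP' ⁻¹' UW ∈ 𝓝 (zc • (1 : Matrix (Fin 2) (Fin 2) ℂ)) := by
    refine hconjP'c.continuousAt.preimage_mem_nhds ?_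
    have h : conjP' (zc • (1 : Matrix (Fin 2) (Fin 2) ℂ)) = zc • 1 := by rw [← hconj_zc, hconj_inv, hconj_zc]
    rw [h]; exact hUW
  -- ### the (W3-G) generator inside that neighbourhood, and the bump on the line
  obtain ⟨f₀, C, δ, hf₀s, hf₀c, hf₀supp, hf₀1, hC, hδ, hG1, hG3⟩ := exists_compactType_wallGenerator L w νw (cw₀ 0) hUf
  obtain ⟨b, hbsupp, hbc, hbs, hb01, hb1⟩ := exists_contDiff_tsupport_subset (n := ⊤) hU1
  -- ### the block function
  refine ⟨fun X => f₀ (conjP (X.submatrix ι ι)) * (b (X (τ 1) (τ 1)) : ℂ), f₀, b, C, δ, ?_, hf₀s, hf₀c, hbs, fun ζ => ⟨(hb01 ⟨ζ, rfl⟩).1, (hb01 ⟨ζ, rfl⟩).2⟩,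
    hb1, fun X => rfl, ?_, hf₀1, hC, hδ, hG1, hG3⟩
  · -- smoothness: linear maps, `f₀`, `b`
    have hsub : ContDiff ℝ ∞ fun X : Matrix (Fin 3) (Fin 3) ℂ => X.submatrix ι ι := by
      let Ls : Matrix (Fin 3) (Fin 3) ℂ →ₗ[ℝ] Matrix (Fin 2) (Fin 2) ℂ :=
        { toFun := fun X => X.submatrix ι ι
          map_add' := fun X Y => by rw [Matrix.submatrix_add]; rfl
          map_smul' := fun c X => by rw [Matrix.submatrix_smul]; rfl }
      exact (LinearMap.toContinuousLinearMap Ls).contDiff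
    have h1 : ContDiff ℝ ∞ fun X : Matrix (Fin 3) (Fin 3) ℂ => f₀ (conjP (X.submatrix ι ι)) := hf₀s.comp (hconjPsmooth.comp hsub)
    have h2 : ContDiff ℝ ∞ fun X : Matrix (Fin 3) (Fin 3) ℂ => (b (X (τ 1) (τ 1)) : ℂ) :=
      Complex.ofRealCLM.contDiff.comp (hbs.comp ((Matrix.entryLinearMap ℝ ℂ (τ 1) (τ 1)).toContinuousLinearMap.contDiff))
    exact h1.mul h2
  · -- the support clause on the centraliser
    intro z hz hΦ
    have hz' : Commute ((z : GL (Fin 3) ℂ) : Matrix (Fin 3) (Fin 3) ℂ) (Matrix.diagonal d) := by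
      rw [← hsd]
      have h := (Subgroup.mem_centralizer_iff.1 hz) s (Set.mem_singleton s)
      have h' := congrArg (fun t : ↥(archLocal L 3 (Matrix.diagonal α) w) => ((t : GL (Fin 3) ℂ) : Matrix (Fin 3) (Fin 3) ℂ)) h
      exact (show ((s : GL (Fin 3) ℂ) : Matrix (Fin 3) (Fin 3) ℂ) * ((z : GL (Fin 3) ℂ) : Matrix (Fin 3) (Fin 3) ℂ) =
        ((z : GL (Fin 3) ℂ) : Matrix (Fin 3) (Fin 3) ℂ) * ((s : GL (Fin 3) ℂ) : Matrix (Fin 3) (Fin 3) ℂ) from h').symm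
    -- the two factors do not vanish
    have hfne : f₀ (conjP ((((z : GL (Fin 3) ℂ) : Matrix (Fin 3) (Fin 3) ℂ)).submatrix ι ι)) ≠ 0 := fun h => hΦ (by simp only [h, zero_mul])
    have hbne : b (((z : GL (Fin 3) ℂ) : Matrix (Fin 3) (Fin 3) ℂ) (τ 1) (τ 1)) ≠ 0 := fun h => hΦ (by simp only [h, Complex.ofReal_zero, mul_zero])
    have hWmem : (((z : GL (Fin 3) ℂ) : Matrix (Fin 3) (Fin 3) ℂ)).submatrix ι ι ∈ UW := by
      have h : conjP ((((z : GL (Fin 3) ℂ) : Matrix (Fin 3) (Fin 3) ℂ)).submatrix ι ι) ∈ tsupport f₀ := subset_tsupport _ hfne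
      have h' := hf₀supp h
      rw [Set.mem_preimage, hconj_inv] at h'
      exact h'
    have h1mem : ((z : GL (Fin 3) ℂ) : Matrix (Fin 3) (Fin 3) ℂ) (τ 1) (τ 1) ∈ U1 := by
      have h : (((z : GL (Fin 3) ℂ) : Matrix (Fin 3) (Fin 3) ℂ) (τ 1) (τ 1)) ∈ tsupport b := subset_tsupport _ hbne
      exact hbsupp h
    -- `↑z = A (z_W, z₁)`
    have hzA : ((z : GL (Fin 3) ℂ) : Matrix (Fin 3) (Fin 3) ℂ) =
        A (((((z : GL (Fin 3) ℂ) : Matrix (Fin 3) (Fin 3) ℂ)).submatrix ι ι), ((z : GL (Fin 3) ℂ) : Matrix (Fin 3) (Fin 3) ℂ) (τ 1) (τ 1)) := by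
      ext i j
      rw [apply_eq_blockAssembly_of_commute_diagonal τ hd02 hd10 hz' i j]
      simp only [hA, Matrix.of_apply, hι]
    rw [hzA]
    exact hWU (Set.mk_mem_prod hWmem h1mem)

end Generator

end Literature.NumberTheory.Rogawski1990

end
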